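import Mathlib
import HarnessLib
import Summits.RiemannHypothesis.RiemannHypothesis.Theorems.IntegerScrewCSharpUpper

/-!
# Route `IntegerScrew` — THEOREM C (PIVOT-LAW 13.34 / CONTINUUM-LIMIT §3) IN THE KERNEL, as the limit form of C♯:
# the return probability of the truncated multiplicative walk at time `τ/log M` converges to `g(τ) = ∫₀²|1−λ|e^{−τλ}dλ`

THEOREM C (rh-explicit A6-PIVOT theory, CONTINUUM-LIMIT §3; proved there by coupling the walk to the star-transposition
walk on `S_n` and to the constrained continuum process) states `P_1(X_{τ/log M} = 1) → g(τ)` as `M → ∞`, with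
`g(τ) = ∫₀² |1−λ| e^{−τλ} dλ = (τ − 1 + 2e^{−τ} − (1+τ)e^{−2τ})/τ²`.  In the kernel it is now a COROLLARY of the
two-sided THEOREM C♯ (`IntegerScrewCSharpUpper.returnProb_csharp`: `e^{−16τ/log M}g ≤ p ≤ e^{65τ/log M}g` for every
`M ≥ 2`) by squeezing, since `c·τ/log M → 0`:

* `tendsto_returnProb` : `(e^{τ·walkGen (M+2)})₁₁ → g(τ)` along `M → ∞` (the shift `M+2` only makes the state `1 ∈ {1,…,M}`
  available without a hypothesis; every `M ≥ 2` is covered);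
* `tendsto_returnProb_integral` : the same with the limit written as THEOREM C prints it, `∫₀² |1−s| e^{−τs} ds`
  (`IntegerScrewHarmonicK.ccpg_eq_integral_abs`).

Unconditional; RH-free; nothing here bears on the truth of RH.  References: CONTINUUM-LIMIT §3, §16; PIVOT-LAW 13.34,
13.44, 13.53; M. Suzuki, J. Lond. Math. Soc. (2) 108 (2023) 1448–1487 [Suzuki2023].
-/

noncomputable section

-- D-0017: `Summit.<S>.<S>.…` is the designed namespace of a single-problem summit.
set_option linter.dupNamespace false

namespace Summit.RiemannHypothesis.RiemannHypothesis.Theorems.IntegerScrew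

open Real Filter Topology

/-- `c/log(M+2) · τ → 0` as `M → ∞`. -/
theorem tendsto_const_div_log_mul (c τ : ℝ) :
    Tendsto (fun M : ℕ => c / Real.log ((M : ℝ) + 2) * τ) atTop (𝓝 0) := by
  have hlog : Tendsto (fun M : ℕ => Real.log ((M : ℝ) + 2)) atTop atTop :=
    Real.tendsto_log_atTop.comp
      (tendsto_atTop_add_const_right atTop (2 : ℝ) tendsto_natCast_atTop_atTop)
  have h1 : Tendsto (fun M : ℕ => c / Real.log ((M : ℝ) + 2)) atTop (𝓝 0) := tendsto_const_nhds.div_atTop hlog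
  simpa using h1.mul_const τ

/-- **THEOREM C (kernel).** For every `τ > 0`: `(e^{τ·walkGen (M+2)})₁₁ → g(τ)` as `M → ∞` — the truncated multiplicative
walk of PIVOT-LAW 13.10 on `{1,…,M+2}`, started at `1`, is back at `1` at time `τ/log(M+2)` with probability tending to
`g(τ)`. -/
theorem tendsto_returnProb {τ : ℝ} (hτ : 0 < τ) :
    Tendsto (fun M : ℕ => (NormedSpace.exp (τ • walkGen (M + 2)))
        (stOne (by omega : 1 ≤ M + 2)) (stOne (by omega : 1 ≤ M + 2))) atTop (𝓝 (ccpg τ)) := by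
  -- the two C♯ envelopes tend to g(τ)
  have hlo : Tendsto (fun M : ℕ => Real.exp (-(16 / Real.log ((M + 2 : ℕ) : ℝ) * τ)) * ccpg τ) atTop (𝓝 (ccpg τ)) := by
    have h := ((tendsto_const_div_log_mul 16 τ).neg).rexp.mul_const (ccpg τ)
    simp only [neg_zero, Real.exp_zero, one_mul] at h
    refine h.congr' (Eventually.of_forall fun M => ?_)
    push_cast; ring_nf
  have hhi : Tendsto (fun M : ℕ => Real.exp (65 / Real.log ((M + 2 : ℕ) : ℝ) * τ) * ccpg τ) atTop (𝓝 (ccpg τ)) := by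
    have h := (tendsto_const_div_log_mul 65 τ).rexp.mul_const (ccpg τ)
    simp only [Real.exp_zero, one_mul] at h
    refine h.congr' (Eventually.of_forall fun M => ?_)
    push_cast; ring_nf
  refine tendsto_of_tendsto_of_tendsto_of_le_of_le hlo hhi (fun M => ?_) (fun M => ?_)
  · exact (returnProb_csharp (M := M + 2) (by omega) hτ).1
  · exact (returnProb_csharp (M := M + 2) (by omega) hτ).2

/-- **THEOREM C as printed**: the limit is `∫₀² |1−s| e^{−τs} ds`. -/
theorem tendsto_returnProb_integral {τ : ℝ} (hτ : 0 < τ) :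
    Tendsto (fun M : ℕ => (NormedSpace.exp (τ • walkGen (M + 2)))
        (stOne (by omega : 1 ≤ M + 2)) (stOne (by omega : 1 ≤ M + 2))) atTop
      (𝓝 (∫ s in (0 : ℝ)..2, |1 - s| * Real.exp (-(τ * s)))) := by
  rw [← ccpg_eq_integral_abs hτ.ne']
  exact tendsto_returnProb hτ

end Summit.RiemannHypothesis.RiemannHypothesis.Theorems.IntegerScrew

end
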